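import Summits.BirchSwinnertonDyer.BirchSwinnertonDyer.Theses.TangentCone
import Literature.Barriers.BirchSwinnertonDyer.DescentDefectUnboundedKramerHoldsProofs
import Literature.NumberTheory.EllipticCurves.BSDSha
import Literature.NumberTheory.EllipticCurves.IwasawaLeadingTermProofs

/-!
# Disproof of `SelmerRankShaPFinite` (stmt-BirchSwinnertonDyer-0132) — standing disprover, cycle 1

Crux (verbatim, `Theses/TangentCone.lean`; shared by SelmerRank / ToricShedding / FrozenTwin /
VerticalContact):
`∀ (W : WeierstrassCurve ℚ) [W.IsElliptic] (p : ℕ) [Fact p.Prime], Finite ↥(AddCommGroup.primaryComponent ↥W.sha p)`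
— the `p`-primary Tate–Shafarevich conjecture over `ℚ`, prime by prime.

## Findings (index)

* §1 READING. `W.sha` is the genuine `Ш(E/ℚ) = ker (H¹(ℚ,E) → ∏_v H¹(ℚ_v,E))` on Mathlib's
  `continuousCohomology 1` (Sha.lean:411); `primaryComponent` is Mathlib's `{x | ∃ n, addOrderOf x = p^n}`.
  No coercion junk, no `0⁻¹`/`sSup`/`tsum`; quantifier order matches the informal text. NO KILL: the
  statement is Silverman AEC Conj. X.4.13 restricted to `p`-primary parts, typed faithfully.
* §2 `Ш[p] ↪ Ш[p^∞]` (`shaTorsionToPrimary`, injective) — the bridge to the tree's PROVED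
  unboundedness of `Ш[2]` (Kramer 1983, `TwoDescentDefectUnbounded_holds`, std axioms).
* §3 NATURAL STRENGTHENINGS REFUTED (sorry-free, landed under `Theorems/SelmerRankShaPFinite/Negative/`):
  `not_shaPrimaryTrivial` — "Ш[p^∞] = 0 for every E/ℚ and p" is FALSE (Kramer's semistable curve, p = 2);
  `not_shaPrimaryEffectivelyBounded` — "Ш[p^∞] finite AND of order ≤ B(p)" is FALSE for every `B : ℕ → ℕ`
  (already at p = 2 over semistable curves): any proof of the crux is ineffective in (E) at fixed p.
* §4 THE CONTENT IS THE DIVISIBLE PART (sorry-free, landed): `not_finite_primary_of_finite_torsionLayers` —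
  for abstract abelian groups, finiteness of EVERY torsion layer `A[n]` (what the tree proves for Ш:
  `finite_shaTorsion`, AEC X.4.2(b)) does not give finiteness of `A[p^∞]` (Prüfer witness `ℚ/ℤ`).
  So no proof can close the crux from `finite_sha_torsionBy`-type input by group theory; the missing
  input is exactly `div(Ш[p^∞]) = 0`, equivalently (census dictionary) `corank_ℤₚ Sel_p∞ ≤ rank E(ℚ)`.
* §5 LOAD-BEARING HYPOTHESES. The crux has two binders only. `[W.IsElliptic]`: NOT refutable when
  dropped — for a singular cubic Mathlib's `Point` is `E_ns`, a form of `𝔾_m` or `𝔾_a` over `ℚ̄`, and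
  `Ш¹(ℚ, T) = 0` for one-dimensional tori (Hasse norm theorem) / `H¹(ℚ, ℚ̄⁺) = 0`; so the binder is
  "possibly unnecessary" for truth (contrast `RankLeOne`/`SqueezeUB`, where the cusp IS a counterexample).
  `[Fact p.Prime]`: cannot be dropped (it is an argument of `primaryComponent`); the junk reading
  `{x | ∃ n, p^n • x = 0}` at p = 0 or 1 is all of Ш, i.e. the full Ш-conjecture — open, not refutable.
  LOCAL CONDITIONS (inside `sha`): dropping them gives `H¹(ℚ,E)[p^∞]` finite, which is FALSE
  (the Weil–Châtelet group has infinitely many elements of every order, AEC X.§4 / Shafarevich 1957) —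
  recorded as `WithoutLocalConditions` (§5), not closed here: needs the Kummer sequence
  `E(ℚ)/p → H¹(ℚ,E[p]) → H¹(ℚ,E)[p] → 0` plus infinitely many independent classes in `H¹(ℚ,E[p])`.
* §6 COUNTEREXAMPLE SHAPE (sorry-free): crux ⟺ ∀ E p, shaCorank = 0 ⟺ ∀ E p, corank Sel_p∞ = rank
  (`crux_iff_forall_selmerCorank_eq_rank`); ¬crux ⟺ ∃ E p, rank < corank (`not_crux_iff_exists_rank_lt_selmerCorank`);
  a p-DEPENDENT Selmer corank kills it (`not_crux_of_selmerCorank_ne`).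
* §7 WHY IT RESISTS. No finite/small model: Ш is defined by continuous Galois cohomology of `E(ℚ̄)`;
  every instance with r_an ≤ 1 is a theorem (Kolyvagin; tree fact `rank_eq_analyticRank_of_analyticRank_le_one`),
  every instance with r_an ≥ 2 is open and numerically consistent (Cremona/Stein–Wuthrich tables: analytic
  Ш ≈ square integer; p-descents certify Ш[p] = 0 ⇒ Ш[p^∞] = 0 case by case). A refutation needs ONE
  curve with an infinitely p-divisible Ш-class — no candidate exists in print (ledger negatives: 1 unrelated
  entry; barrier catalogue: `SelmerRankBarrierNarrow` records exactly this input as the open one).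
  What the route CONSUMES is far less (one good ordinary p ≥ 5 at a curve with corank = r_an ≥ 2, where the
  instance ⟺ rank = r_an): planner business (restatement), see `Lines/Sketch_dead.md`, STRATEGY-CENSUS.md.
-/

set_option linter.dupNamespace false

noncomputable section

open scoped Classical

namespace Summit.BirchSwinnertonDyer.BirchSwinnertonDyer.Cruxes.SelmerRankShaPFinite.Disproof

open Summit.BirchSwinnertonDyer.BirchSwinnertonDyer.Theses.TangentCone
open Literature.Barriers.BirchSwinnertonDyer
open Literature.NumberTheory.EllipticCurves
open WeierstrassCurve

/-! ## §1 Reading -/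

/-- The crux unfolds to the faithful statement (no hidden coercion or junk operator). [folklore] -/
theorem crux_iff :
    SelmerRankShaPFinite ↔ ∀ (W : WeierstrassCurve ℚ) [W.IsElliptic] (p : ℕ) [Fact p.Prime],
      Finite ↥(AddCommGroup.primaryComponent (↥W.sha) p) :=
  Iff.rfl

/-- The full Tate–Shafarevich conjecture over `ℚ` (AEC Conj. X.4.13, tree `ShaFiniteConjecture`)
implies the crux (a subgroup of a finite group is finite): the crux is the WEAKER, prime-by-prime
statement. [folklore] -/
theorem crux_of_shaFiniteConjecture (h : ShaFiniteConjecture) : SelmerRankShaPFinite := by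
  intro W hW p _
  haveI : Finite ↥W.sha := h W hW
  infer_instance

/-! ## §2 `Ш[p] ↪ Ш[p^∞]` -/

/-- An element killed by a prime `p` lies in the `p`-primary component (its order is `1` or `p`).
[folklore] -/
theorem mem_primaryComponent_of_prime_nsmul_eq_zero {G : Type*} [AddCommGroup G] (p : ℕ)
    [hp : Fact p.Prime] {y : G} (hy : p • y = 0) : y ∈ AddCommGroup.primaryComponent G p := by
  rw [AddCommGroup.mem_primaryComponent_iff_addOrderOf]
  rcases (Nat.dvd_prime hp.out).mp (addOrderOf_dvd_of_nsmul_eq_zero hy) with h | h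
  · exact ⟨0, by rw [h, pow_zero]⟩
  · exact ⟨1, by rw [h, pow_one]⟩

variable (W : WeierstrassCurve ℚ)

/-- **`Ш(E/ℚ)[p] → Ш(E/ℚ)[p^∞]`**: the inclusion of the `p`-torsion of Ш (tree spelling
`shaTorsion W p = W.sha ⊓ H¹(ℚ,E)[p]`) into the `p`-primary component of Ш. [folklore] -/
def shaTorsionToPrimary (p : ℕ) [Fact p.Prime] :
    ↥(shaTorsion W (p : ℤ)) →+ ↥(AddCommGroup.primaryComponent (↥W.sha) p) where
  toFun x := ⟨⟨(x : W.galH1), (AddSubgroup.mem_inf.mp x.2).1⟩,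
    mem_primaryComponent_of_prime_nsmul_eq_zero p (by
      apply Subtype.ext
      have hx : ((p : ℤ)) • (x : W.galH1) = 0 := (AddSubgroup.mem_inf.mp x.2).2
      rw [natCast_zsmul] at hx
      simpa using hx)⟩
  map_zero' := rfl
  map_add' _ _ := rfl

/-- `shaTorsionToPrimary` is injective (it is the identity on underlying classes). [folklore] -/
theorem shaTorsionToPrimary_injective (p : ℕ) [Fact p.Prime] :
    Function.Injective (shaTorsionToPrimary W p) := by
  intro x y h
  have := congrArg (fun z : ↥(AddCommGroup.primaryComponent (↥W.sha) p) => ((z : ↥W.sha) : W.galH1)) h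
  exact Subtype.ext this

/-- Kramer's theorem transported: for every `C` a semistable elliptic `E/ℚ` with a copy of
`(ℤ/2)^C` inside `Ш(E/ℚ)[2^∞]`. [cite: Kramer1983, Theorem (§5)] -/
theorem exists_twoRank_shaPrimary_ge (C : ℕ) :
    ∃ W : WeierstrassCurve ℚ, W.IsElliptic ∧ W.IsSemistable ℤ ∧
      nRankAtLeast ↥(AddCommGroup.primaryComponent (↥W.sha) 2) 2 C := by
  haveI : Fact (Nat.Prime 2) := ⟨Nat.prime_two⟩
  obtain ⟨W, hW, hss, hrk⟩ := TwoDescentDefectUnbounded_holds C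
  exact ⟨W, hW, hss, hrk.of_injective _ (shaTorsionToPrimary_injective W 2)⟩

/-! ## §3 Natural strengthenings refuted -/

/-- STRENGTHENING 1: "`Ш(E/ℚ)[p^∞]` is TRIVIAL for every elliptic `E/ℚ` and every prime `p`". -/
def ShaPrimaryTrivial : Prop :=
  ∀ (W : WeierstrassCurve ℚ) [W.IsElliptic] (p : ℕ) [Fact p.Prime],
    Subsingleton ↥(AddCommGroup.primaryComponent (↥W.sha) p)

/-- **`ShaPrimaryTrivial` is false**: Kramer's semistable curve has `(ℤ/2)^1 ↪ Ш[2] ⊆ Ш[2^∞]`.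
So the crux cannot be proved by showing Ш[p^∞] vanishes. [cite: Kramer1983, Theorem (§5)] -/
theorem not_shaPrimaryTrivial : ¬ ShaPrimaryTrivial := by
  intro h
  haveI : Fact (Nat.Prime 2) := ⟨Nat.prime_two⟩
  obtain ⟨W, hW, -, f, hf⟩ := exists_twoRank_shaPrimary_ge 1
  haveI := hW
  haveI := h W 2
  have h01 : (fun _ => 1 : Fin 1 → ZMod 2) = 0 := hf (Subsingleton.elim _ _)
  exact one_ne_zero (congrFun h01 0)

/-- STRENGTHENING 2 (effective crux): "`Ш(E/ℚ)[p^∞]` is finite AND its order is bounded by a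
function of `p` alone". -/
def ShaPrimaryEffectivelyBounded : Prop :=
  ∃ B : ℕ → ℕ, ∀ (W : WeierstrassCurve ℚ) [W.IsElliptic] (p : ℕ) [Fact p.Prime],
    Finite ↥(AddCommGroup.primaryComponent (↥W.sha) p) ∧
      Nat.card ↥(AddCommGroup.primaryComponent (↥W.sha) p) ≤ B p

/-- **`ShaPrimaryEffectivelyBounded` is false**, already at `p = 2` over semistable curves:
`|Ш[2^∞]| ≥ |copy of (ℤ/2)^{B 2}| = 2^{B 2} > B 2`. Any proof of the crux is necessarily
ineffective in `E` at a fixed prime. [cite: Kramer1983, Theorem (§5)] -/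
theorem not_shaPrimaryEffectivelyBounded : ¬ ShaPrimaryEffectivelyBounded := by
  rintro ⟨B, hB⟩
  haveI : Fact (Nat.Prime 2) := ⟨Nat.prime_two⟩
  obtain ⟨W, hW, -, hrk⟩ := exists_twoRank_shaPrimary_ge (B 2)
  haveI := hW
  obtain ⟨hfin, hcard⟩ := hB W 2
  have hpow : 2 ^ B 2 ≤ Nat.card ↥(AddCommGroup.primaryComponent (↥W.sha) 2) := hrk.pow_le_card
  exact absurd (hpow.trans hcard) (not_le.mpr (B 2).lt_two_pow_self)

/-- The uniform version (one bound for all `p`) is a fortiori false. [cite: Kramer1983, Theorem (§5)] -/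
theorem not_shaPrimaryUniformlyBounded :
    ¬ ∃ B : ℕ, ∀ (W : WeierstrassCurve ℚ) [W.IsElliptic] (p : ℕ) [Fact p.Prime],
      Finite ↥(AddCommGroup.primaryComponent (↥W.sha) p) ∧
        Nat.card ↥(AddCommGroup.primaryComponent (↥W.sha) p) ≤ B := by
  rintro ⟨B, hB⟩
  exact not_shaPrimaryEffectivelyBounded ⟨fun _ => B, fun W _ p _ => hB W p⟩

/-! ## §4 The content of the crux is the divisible part: torsion layers do not suffice -/

/-- In `ℚ/ℤ = AddCircle (1 : ℚ)` every torsion layer `A[n]`, `n > 0`, is finite. [folklore] -/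
theorem finite_torsionBy_addCircle (n : ℕ) (hn : 0 < n) :
    Finite ↥(AddSubgroup.torsionBy (AddCircle (1 : ℚ)) (n : ℤ)) := by
  have hsub : ((AddSubgroup.torsionBy (AddCircle (1 : ℚ)) (n : ℤ)) : Set (AddCircle (1 : ℚ))) ⊆
      ⋃ d ∈ n.divisors, {u : AddCircle (1 : ℚ) | addOrderOf u = d} := by
    intro u hu
    have hu' : (n : ℤ) • u = 0 := hu
    rw [natCast_zsmul] at hu'
    simp only [Set.mem_iUnion, Set.mem_setOf_eq, exists_prop]
    exact ⟨addOrderOf u, Nat.mem_divisors.mpr ⟨addOrderOf_dvd_of_nsmul_eq_zero hu', hn.ne'⟩, rfl⟩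
  have hfin : (⋃ d ∈ n.divisors, {u : AddCircle (1 : ℚ) | addOrderOf u = d}).Finite := by
    refine Set.Finite.biUnion (Finset.finite_toSet _) fun d hd => ?_
    exact AddCircle.finite_setOf_addOrderOf_eq (1 : ℚ) (Nat.pos_of_mem_divisors hd)
  exact (hfin.subset hsub).to_subtype

/-- In `ℚ/ℤ` the `p`-primary component (the Prüfer group `ℚ_p/ℤ_p`) is infinite: the classes of
`1/p^k` have the distinct orders `p^k`. [folklore] -/
theorem not_finite_primaryComponent_addCircle (p : ℕ) [hp : Fact p.Prime] :
    ¬ Finite ↥(AddCommGroup.primaryComponent (AddCircle (1 : ℚ)) p) := by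
  haveI : Fact ((0 : ℚ) < 1) := ⟨one_pos⟩
  let f : ℕ → AddCircle (1 : ℚ) := fun k => (((1 : ℚ) / ((p ^ k : ℕ) : ℚ) : ℚ) : AddCircle (1 : ℚ))
  have hord : ∀ k, addOrderOf (f k) = p ^ k := fun k =>
    AddCircle.addOrderOf_period_div (pow_pos hp.out.pos k)
  have hmem : ∀ k, f k ∈ (AddCommGroup.primaryComponent (AddCircle (1 : ℚ)) p : Set (AddCircle (1 : ℚ))) :=
    fun k => (AddCommGroup.mem_primaryComponent_iff_addOrderOf).mpr ⟨k, hord k⟩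
  have hinj : Function.Injective f := by
    intro k l hkl
    have := congrArg addOrderOf hkl
    rw [hord, hord] at this
    exact Nat.pow_right_injective hp.out.two_le this
  have hinf := Set.infinite_of_injective_forall_mem hinj hmem
  intro hfin
  exact hinf (Set.toFinite _)

/-- **Torsion layers do not control the primary component.** It is NOT true that an abelian group all
of whose torsion layers `A[n]` (`n > 0`) are finite has finite `p`-primary components: `ℚ/ℤ` is a
witness at every prime. For `A = Ш(E/ℚ)` the hypothesis is the tree THEOREM `finite_shaTorsion`
(AEC X.4.2(b)); hence the crux is not a group-theoretic consequence of the finiteness of the `Ш[n]`,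
and its entire content is the vanishing of the divisible part of `Ш[p^∞]`. [folklore] -/
theorem not_finite_primary_of_finite_torsionLayers :
    ¬ ∀ (A : Type) [AddCommGroup A] (p : ℕ) [Fact p.Prime],
        (∀ n : ℕ, 0 < n → Finite ↥(AddSubgroup.torsionBy A (n : ℤ))) →
          Finite ↥(AddCommGroup.primaryComponent A p) := by
  intro h
  haveI : Fact (Nat.Prime 2) := ⟨Nat.prime_two⟩
  exact not_finite_primaryComponent_addCircle 2 (h (AddCircle (1 : ℚ)) 2 finite_torsionBy_addCircle)

/-- For Ш itself: every torsion layer IS finite (tree theorem, Kramer barrier proofs / AEC X.4.2), so by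
the previous lemma nothing short of the divisible part separates the known from the crux. [folklore] -/
theorem finite_shaTorsion_layers (W : WeierstrassCurve ℚ) [W.IsElliptic] (n : ℕ) (hn : 0 < n) :
    Finite ↥(shaTorsion W (n : ℤ)) :=
  finite_shaTorsion W (by exact_mod_cast hn.ne')

/-! ## §5 Load-bearing hypotheses (record; no kill) -/

/-- The crux with the instance binder `[W.IsElliptic]` DROPPED. NOT refuted and believed TRUE: for a
singular cubic Mathlib's `Point` type is the group of non-singular points `E_ns`, geometrically
`𝔾_a` (cusp) or a one-dimensional torus (node), and `H¹(ℚ, ℚ̄⁺) = 0`, `Ш¹(ℚ, T) = 0` for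
one-dimensional tori (Hilbert 90 / Hasse norm theorem), so Ш = 0 there. Information for the prover:
`IsElliptic` is possibly unnecessary for TRUTH (it is of course where all the difficulty lives).
[folklore] -/
def WithoutIsElliptic : Prop :=
  ∀ (W : WeierstrassCurve ℚ) (p : ℕ) [Fact p.Prime], Finite ↥(AddCommGroup.primaryComponent (↥W.sha) p)

/-- `WithoutIsElliptic` trivially implies the crux (recorded to fix the direction of the mutation).
[folklore] -/
theorem crux_of_withoutIsElliptic (h : WithoutIsElliptic) : SelmerRankShaPFinite :=
  fun W _ p _ => h W p

/-- The crux with the LOCAL CONDITIONS dropped: "`H¹(ℚ, E)[p^∞]` is finite". FALSE in print (the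
Weil–Châtelet group of an elliptic curve over a number field has infinitely many elements of every
order `n`: Shafarevich 1957; Silverman AEC X.§4, Exercise 10.12/Remark) — so the local conditions are
load-bearing — but NOT closed here: a Lean proof needs the Kummer sequence
`0 → E(ℚ)/pE(ℚ) → H¹(ℚ, E[p]) → H¹(ℚ, E)[p] → 0` (tree: `selmer_exact_holds` covers only the Selmer
part) and an infinite supply of independent classes in `H¹(ℚ, E[p])` (e.g. quadratic characters
when `E[2] ⊆ E(ℚ)`). Near-miss, left open deliberately (no `sorry` kept in this file). [folklore] -/
def WithoutLocalConditions : Prop :=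
  ∀ (W : WeierstrassCurve ℚ) [W.IsElliptic] (p : ℕ) [Fact p.Prime],
    Finite ↥(AddCommGroup.primaryComponent W.galH1 p)

/-! ## §6 Counterexample shape (what a kill would have to exhibit) -/

/-- Dictionary (tree theorems only: cofinite generation `finite_primaryComponent_sha_iff_shaCorank_eq_zero`):
the crux ⟺ every `corank_ℤₚ Ш(E/ℚ)[p^∞]` vanishes. [folklore] -/
theorem crux_iff_forall_shaCorank_eq_zero :
    SelmerRankShaPFinite ↔
      ∀ (W : WeierstrassCurve ℚ) [W.IsElliptic] (p : ℕ) [Fact p.Prime], W.shaCorank p = 0 := by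
  constructor
  · intro h W _ p _
    exact (finite_primaryComponent_sha_iff_shaCorank_eq_zero W p).mp (h W p)
  · intro h W _ p _
    exact (finite_primaryComponent_sha_iff_shaCorank_eq_zero W p).mpr (h W p)

/-- Dictionary, rank form (Greenberg's identity `selmerCorank_eq_mordellWeilRank_add_holds`, a tree
theorem): the crux ⟺ `corank_ℤₚ Sel_p∞(E/ℚ) = rank E(ℚ)` for every elliptic `E/ℚ` and every `p` —
no L-function occurs; it is the existence of `corank` many independent rational points, uniformly.
[folklore] -/
theorem crux_iff_forall_selmerCorank_eq_rank :
    SelmerRankShaPFinite ↔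
      ∀ (W : WeierstrassCurve ℚ) [W.IsElliptic] (p : ℕ) [Fact p.Prime],
        W.selmerCorank p = W.mordellWeilRank := by
  rw [crux_iff_forall_shaCorank_eq_zero]
  refine forall_congr' fun W => forall_congr' fun _ => forall_congr' fun p => forall_congr' fun _ => ?_
  rw [W.selmerCorank_eq_mordellWeilRank_add_holds p]
  omega

/-- **Counterexample shape.** The crux fails iff SOME elliptic `E/ℚ` at SOME prime has
`rank E(ℚ) < corank_ℤₚ Sel_p∞(E/ℚ)`, i.e. an infinitely `p`-divisible class in Ш. Nothing of the
kind is known or conjectured for any curve (for `r_an ≤ 1` it is excluded by Kolyvagin); this is why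
no cheap kill exists. [folklore] -/
theorem not_crux_iff_exists_rank_lt_selmerCorank :
    ¬ SelmerRankShaPFinite ↔
      ∃ (W : WeierstrassCurve ℚ) (_ : W.IsElliptic) (p : ℕ) (_ : Fact p.Prime),
        W.mordellWeilRank < W.selmerCorank p := by
  rw [crux_iff_forall_selmerCorank_eq_rank]
  constructor
  · intro h
    by_contra hne
    apply h
    intro W hW p hp
    have hle : W.mordellWeilRank ≤ W.selmerCorank p := by
      rw [W.selmerCorank_eq_mordellWeilRank_add_holds p]; exact Nat.le_add_right _ _
    by_contra hneq
    exact hne ⟨W, hW, p, hp, lt_of_le_of_ne hle (Ne.symm hneq)⟩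
  · rintro ⟨W, hW, p, hp, hlt⟩ h
    exact (lt_irrefl _) (lt_of_lt_of_eq hlt (@h W hW p hp))

/-- **A curve whose Selmer corank depends on the prime kills the crux** (under the crux every
corank equals the rank). Independence of `p` of `corank_ℤₚ Sel_p∞(E/ℚ)` is itself open in general
(known for `r_an ≤ 1`), so this is a SHAPE, not a kill. [folklore] -/
theorem not_crux_of_selmerCorank_ne (W : WeierstrassCurve ℚ) [W.IsElliptic] (p q : ℕ)
    [Fact p.Prime] [Fact q.Prime] (h : W.selmerCorank p ≠ W.selmerCorank q) :
    ¬ SelmerRankShaPFinite := by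
  rw [crux_iff_forall_selmerCorank_eq_rank]
  intro hc
  exact h ((hc W p).trans (hc W q).symm)

/-- Under the crux the `2`-primary corank vanishes too, although `Ш[2^∞] ≠ 0` does occur
(`not_shaPrimaryTrivial`): finiteness, not vanishing, is the claim, and Kramer's curves are no
threat to it (their `Ш[2]` is finite: `finite_shaTorsion_layers`). [folklore] -/
theorem crux_consistent_with_kramer (h : SelmerRankShaPFinite) (C : ℕ) :
    ∃ W : WeierstrassCurve ℚ, W.IsElliptic ∧
      nRankAtLeast ↥(AddCommGroup.primaryComponent (↥W.sha) 2) 2 C ∧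
        Finite ↥(AddCommGroup.primaryComponent (↥W.sha) 2) := by
  haveI : Fact (Nat.Prime 2) := ⟨Nat.prime_two⟩
  obtain ⟨W, hW, -, hrk⟩ := exists_twoRank_shaPrimary_ge C
  haveI := hW
  exact ⟨W, hW, hrk, h W 2⟩

/-- **The consumed instance is the summit instance.** Where `TangentCone.closes` (and the sibling
routes) actually use the crux — at a curve `V` and prime `p` with `corank_ℤₚ Sel_p∞(V) = r_an(V)`
already in hand — the crux instance is EQUIVALENT to `rank V(ℚ) = r_an(V)`, i.e. to BSD-rank for `V`
(re-derivation of the census theorem `finite_at_iff_bsd_at`, whose module is not built on the farm).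
So on its consumed sector the crux is exactly as hard as the summit for those curves; off that sector
(p = 2, 3, bad, supersingular, small image; r_an ≤ 1) it is surplus. [folklore] -/
theorem crux_instance_iff_rank_eq_analyticRank (V : WeierstrassCurve ℚ) [V.IsElliptic] (p : ℕ)
    [Fact p.Prime] (hs : V.selmerCorank p = V.analyticRank) :
    Finite ↥(AddCommGroup.primaryComponent (↥V.sha) p) ↔ V.mordellWeilRank = V.analyticRank := by
  rw [finite_primaryComponent_sha_iff_shaCorank_eq_zero V p]
  have h := V.selmerCorank_eq_mordellWeilRank_add_holds p
  omega

end Summit.BirchSwinnertonDyer.BirchSwinnertonDyer.Cruxes.SelmerRankShaPFinite.Disproof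

end
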